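import Summits.QuantumFields.BalabanUV.T4Continuum.Support.VariationalColourTwoRunsEnd
import Summits.QuantumFields.BalabanUV.T4Continuum.Support.VariationalColourNestedTaxiFrames
import Summits.QuantumFields.BalabanUV.T4Continuum.Support.VariationalColourTaxiTwoTowers

/-!
# T⁴ programme, spine node NE2 (U1a), lane P2 — SUPPLIER ITEM «V-COL-TWO-RUNS», file 4: THE COLOUR 0-FORM TWO-RUNS END AT TAXI DATA — a SEQUENCE OF RUNS, each a COHERENT
# tower of UNITARY one-step bond operators in the plaquette class, consecutive runs tied ONLY by the distances of their ONE-STEP BOND FIELDS (node NE3's currency on the bond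
# fields, DISPLAYED) ⟹ the run-diagonal colour effective operators `X_k = effC (L^k) M (coarseTv (R′ k k)) (nestTv (R′ k) k) ob a₀` converge at rate `max(L⁻¹, θ)`;
# NO frame, NO transport datum, NO leaf displayed (model level; cell `pub-balaban`)

NE2 formalisation swarm `b2b-balaban-t4-ne2-formalise-*`, leaf prover 02 (gen 6); register P2-sup, item «V-COL-TWO-RUNS» file 4 (INTENT CLAIMS.log l.17982 + addendum).
Composition BY NAME of file 2 `VariationalColourTwoRunsEnd.towerLimitRate_colourTwoRuns_closed_local`, file 3 `VariationalColourTaxiTwoTowers.{norm_coarseTv_sub_coarseTv_le,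
norm_nestTv_sub_nestTv_le}` (the two-run class at taxi data from bond-field distances), «V-COL-TAXI-0FORM-END» file 1 `VariationalColourNestedTaxiFrames.{hrel_nestTv, class_bounds,
lt_one_of_four_sq_le, hw₀_taxi, hw₁_taxi, hin_taxi}`, «V-COL-LOCAL» `hUBc_colour_rel`, `VariationalColourPoincarePhys.qWv_le_coarse_rel` (run k's UB⁺∕P⁺ in leaf shape, from the
straight level-k taxi of run k as reference) and leaf-04-g4's operator taxi dictionary.
THE DATA.  `R′ : ℕ → (k : ℕ) → Tor (fine L (fine (L^k) M)) → Fin d → (E →L[ℂ] E)` — run `r`'s one-step bond fields at every level; each run UNITARY, COHERENT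
(`coarseTv (R′ r (k+1)) = Rtrv (R′ r k)`), in the plaquette class `(L^k·L)²·b_k ≤ c` (k-uniform in `r`); the TWO-RUN CLASS ON THE BOND FIELDS: `‖R′ (k+1) j x μ − R′ k j x μ‖ ≤ σ k j`
with `L^k·(L·σ k k) ≤ c_ρ·θ^k` (the level-`k` bonds of runs `k`, `k+1`) and `Σ_{j<k} d·(L−1)·σ k j ≤ c_τ·θ^k` (the nested contours), `0 ≤ θ < 1`.  Level `k` of the tower is run `k`'s
colour effective operator at ITS level-`k` data (bonds `coarseTv (R′ k k)`, frames `nestTv (R′ k) k`); level `k+1` is run `k+1`'s.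
 * **`towerLimitRate_colourTwoRunsTaxi`**: `TowerLimitRate (fun _ ↦ 1) 1 (k ↦ effC (L^k) M (coarseTv L (fine (L^k) M) (R′ k k)) (nestTv L M (R′ k) k) ob a₀) (C_pair + C_lip) (max L⁻¹ θ)`
   with `C_pair` = «V-COL-TAXI-0FORM-END»'s constant (`c_w′ = (4+(d−1)c)∕(1−((d−1)+d²)c)`, `c_p = c`, `c_m = (d−1)c`, `c₁ = 2(d−1)c`) and `C_lip = eV Λc⋆ 136 (√d·c_ρ + √Λc⋆·c_τ)`,
   from: `1 ≤ d`, `2 ≤ L`, `1 < M_μ`, the two numeric smallness lines `64d((d−1)c)² ≤ ½`, `2d((d−1)c)² + 4(((d−1)+d²)c)² ≤ ½`, and the two-run class on the bond fields —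
   NOTHING ELSE (every pair ∕ repair ∕ transport binder of file 2 discharged: run k's UB⁺∕P⁺ via its straight taxi as reference, run k+1's pair as in «V-COL-TAXI-0FORM-END»,
   `ρ_k = L·σ k k` and `τ_k = Σ_{j<k} d(L−1)σ k j` by file 3).
WHAT IS NOT HERE (stated, not hidden): the two-run class itself (node NE3's business — a colour NE3 adapter from `T4EtaRateMin.LocalRate` is NOT written); any identification with
Bałaban's runs `U_k` (no B0, c5); 1-forms.

HONEST FRAMING (T4-DAG p. 1).  Instantiation at MODEL level (unitary bond operators DATA; taxi ∕ straight contours OURS; [Balaban1985BackgroundPropagators] (3.10) ∕ (3.15) ∕ (3.19)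
SHAPES only, no B0, c5); the two-run class is a HYPOTHESIS in NE3's currency, NOT discharged; honest limit «small field PER UNIT BLOCK through the class constant c»; [folklore]
plumbing + real arithmetic; nothing printed is a hypothesis; no `def`, no `def … : Prop`, no `sorry`; axioms standard.  NE2 NOT proved on either road; NE3 OPEN; spine PROVED 0∕9;
rung (B)+1 finite T⁴ — NOT infinite volume, NOT mass gap, NOT Clay.  HONEST DEPENDENCY (cell, verbatim): continuum YM on T⁴ ⇐ BetaPertH ∧ nine spine estimates (0/9 proved);
BetaPertH ⇐ (D1) ∧ (D4) ∧ CAP+tail; G-an2-4 gates asym, D1 and NE2/3/4.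
-/

noncomputable section

namespace Summit.QuantumFields.BalabanUV.T4Continuum.VariationalColourTwoRunsTaxiEnd

open Finset
open scoped Matrix
open Literature.MathematicalPhysics.QuantumFieldTheory.Balaban1983to89
open Literature.MathematicalPhysics.QuantumFieldTheory.Balaban1983to89.B5Prop11Plancherel (Tor fine unitVec)
open Literature.MathematicalPhysics.QuantumFieldTheory.Balaban1983to89.B5Block118 (bpt)
open Literature.MathematicalPhysics.QuantumFieldTheory.Balaban1983to89.B5Blocks16 (blockOf)
open Summit.QuantumFields.BalabanUV.T4Continuum.CovariantAveragingTower (TowerLimitRate)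
open Summit.QuantumFields.BalabanUV.T4Continuum.VariationalColourFederbush (misv norm_le_one_of_mem_unitary)
open Summit.QuantumFields.BalabanUV.T4Continuum.VariationalColourUpperBound (nsqv)
open Summit.QuantumFields.BalabanUV.T4Continuum.VariationalColourScalarPair (Scv qWv Qkv)
open Summit.QuantumFields.BalabanUV.T4Continuum.VariationalColourPoincarePhys (qWv_le_coarse_rel)
open Summit.QuantumFields.BalabanUV.T4Continuum.VariationalColourTower (compTv Rtrv)
open Summit.QuantumFields.BalabanUV.T4Continuum.VariationalColourTaxiTransport
open Summit.QuantumFields.BalabanUV.T4Continuum.VariationalEffectiveHilbertPairs (effC)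
open Summit.QuantumFields.BalabanUV.T4Continuum.VariationalVectorEndOfLeaves (eV ePV)
open Summit.QuantumFields.BalabanUV.T4Continuum.VariationalColourTowerEndLocal (hUBc_colour_rel)
open Summit.QuantumFields.BalabanUV.T4Continuum.VariationalColourNestedTaxiFrames (hrel_nestTv class_bounds lt_one_of_four_sq_le hw₀_taxi hw₁_taxi hin_taxi)
open Summit.QuantumFields.BalabanUV.T4Continuum.VariationalColourTwoRunsEnd (towerLimitRate_colourTwoRuns_closed_local)
open Summit.QuantumFields.BalabanUV.T4Continuum.VariationalColourTaxiTwoTowers (norm_coarseTv_sub_coarseTv_le norm_nestTv_sub_nestTv_le)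

variable {d : ℕ} {E : Type*} [NormedAddCommGroup E] [InnerProductSpace ℂ E] [CompleteSpace E] [FiniteDimensional ℂ E]
variable (L : ℕ) [NeZero L] (M : Fin d → ℕ) [hM : ∀ μ, NeZero (M μ)] {κ : Type*} [Fintype κ] [DecidableEq κ]

/-- **THE COLOUR 0-FORM TWO-RUNS END AT TAXI DATA — ONLY THE BOND FIELDS AND THEIR TWO-RUN CLASS.**  Runs `R′ r` (UNITARY, COHERENT, plaquette class `(L^k·L)²·b_k ≤ c`),
consecutive runs' one-step bond fields within `σ k j` at level `j` with `L^k·(L·σ k k) ≤ c_ρθ^k` and `Σ_{j<k} d(L−1)σ k j ≤ c_τθ^k`, `0 ≤ θ < 1`; `1 ≤ d`, `2 ≤ L`, `1 < M_μ`, the two numeric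
smallness lines on `c`, `0 < a₀` ⟹ `TowerLimitRate (fun _ ↦ 1) 1 (k ↦ effC (L^k) M (coarseTv (R′ k k)) (nestTv (R′ k) k) ob a₀) (C_pair + C_lip) (max L⁻¹ θ)`.
The two-run class is node NE3's currency, DISPLAYED; NE2 NOT proved. [folklore] -/
theorem towerLimitRate_colourTwoRunsTaxi (hd : 1 ≤ d) (hL : 2 ≤ L) (hM2 : ∀ μ, 1 < M μ)
    {R' : ℕ → (k : ℕ) → Tor (fine L (fine (L ^ k) M)) → Fin d → (E →L[ℂ] E)} (hU : ∀ r k x μ, R' r k x μ ∈ unitary (E →L[ℂ] E))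
    {b : ℕ → ℝ} (hb0 : ∀ k, 0 ≤ b k)
    (hb : ∀ r k x κ ι,
      ‖R' r k x κ * R' r k (x + unitVec (fine L (fine (L ^ k) M)) κ) ι - R' r k x ι * R' r k (x + unitVec (fine L (fine (L ^ k) M)) ι) κ‖ ≤ b k)
    (hcoh : ∀ r k, coarseTv L (fine (L ^ (k + 1)) M) (R' r (k + 1)) = Rtrv (L ^ k) L M (R' r k))
    {c : ℝ} (hclass : ∀ k, ((((L ^ k : ℕ)) : ℝ) * L) ^ 2 * b k ≤ c)
    (hc₁ : 64 * (d : ℝ) * (((d - 1 : ℕ) : ℝ) * c) ^ 2 ≤ 1 / 2)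
    (hc₂ : 2 * (d : ℝ) * (((d - 1 : ℕ) : ℝ) * c) ^ 2 + 4 * (((((d - 1 : ℕ) : ℝ) + (d : ℝ) * d) * c)) ^ 2 ≤ 1 / 2)
    -- the TWO-RUN CLASS ON THE BOND FIELDS (node NE3's currency, displayed)
    (σ : ℕ → ℕ → ℝ) (hσ0 : ∀ k j, 0 ≤ σ k j) (hσ : ∀ k j x μ, ‖R' (k + 1) j x μ - R' k j x μ‖ ≤ σ k j)
    {θ cρ cτ : ℝ} (hθ0 : 0 ≤ θ) (hθ1 : θ < 1)
    (hρc : ∀ k, (((L ^ k : ℕ)) : ℝ) * ((L : ℝ) * σ k k) ≤ cρ * θ ^ k)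
    (hτc : ∀ k, ∑ j ∈ Finset.range k, (d : ℝ) * (((L - 1 : ℕ) : ℝ) * σ k j) ≤ cτ * θ ^ k)
    (ob : OrthonormalBasis κ ℂ E) {a₀ : ℝ} (ha₀ : 0 < a₀) :
    let cw : ℝ := (4 + ((d - 1 : ℕ) : ℝ) * c) / (1 - (((d - 1 : ℕ) : ℝ) + (d : ℝ) * d) * c)
    let cm : ℝ := ((d - 1 : ℕ) : ℝ) * c
    let c₁ : ℝ := 2 * ((d - 1 : ℕ) : ℝ) * c
    let Λcs : ℝ := 2 * d * (36 : ℝ) ^ d * ((1 + cw) ^ 2 + 9)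
    let CRs : ℝ := 2 * Λcs + 2 * d * c + (d : ℝ) ^ 2 * c ^ 2 * 136
    let cε : ℝ := ((d : ℝ) / 4 + 1 / 2) * L
    let cδ' : ℝ := Real.sqrt (2 * d * (1 + (d : ℝ) ^ 2)) * ((L : ℝ) * c₁)
    let Λs : ℝ := Λcs + (cε * CRs + 2 * cδ' * Real.sqrt ((1 + cε * CRs) * 136) + cδ' ^ 2 * 136) * (Λcs + 1)
    TowerLimitRate (ι := fun _ => Tor M × κ) (fun _ => (1 : Matrix (Tor M × κ) (Tor M × κ) ℂ)) 1
      (fun k => effC (L ^ k) M (coarseTv L (fine (L ^ k) M) (R' k k)) (nestTv L M (R' k) k) ob a₀)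
      (eV Λs 136 (Real.sqrt d * cm) + ePV Λs 136 CRs cε cδ' + eV Λcs 136 (Real.sqrt d * cρ + Real.sqrt Λcs * cτ)) (max ((L : ℝ)⁻¹) θ) := by
  intro cw cm c₁ Λcs CRs cε cδ' Λs
  have hL1 : 1 ≤ L := by omega
  have hL1r : (1 : ℝ) ≤ L := by exact_mod_cast hL1
  have hd0 : 0 < d := hd
  have hR' : ∀ r k x μ, ‖R' r k x μ‖ ≤ 1 := fun r k x μ => norm_le_one_of_mem_unitary (hU r k x μ)
  have hc0 : 0 ≤ c := le_trans (by have := hb0 0; positivity) (hclass 0)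
  -- the relative operator `γ := ((d−1)+d²)c` is `< 1` (from `4γ² ≤ ½`)
  set γ : ℝ := (((d - 1 : ℕ) : ℝ) + (d : ℝ) * d) * c with hγdef
  have hγsq : 4 * γ ^ 2 ≤ 1 / 2 := by
    have h0 : 0 ≤ 2 * (d : ℝ) * (((d - 1 : ℕ) : ℝ) * c) ^ 2 := by positivity
    linarith
  have hγ1 : γ < 1 := lt_one_of_four_sq_le hγsq
  have hγ' : 0 < 1 - γ := by linarith
  -- the class lines per level
  have hn1 : ∀ k, 1 ≤ L ^ k := fun k => Nat.one_le_iff_ne_zero.mpr (NeZero.ne (L ^ k))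
  have hcls := fun k => class_bounds (d := d) (hn1 k) hL1 (hb0 k) (hclass k)
  -- the fictitious defect `w′ k := cw / L^k`
  have hnk : ∀ k, (0 : ℝ) < (((L ^ k : ℕ)) : ℝ) := fun k => by exact_mod_cast Nat.pos_of_ne_zero (NeZero.ne (L ^ k))
  have hcw : cw = (4 + ((d - 1 : ℕ) : ℝ) * c) / (1 - γ) := rfl
  have hcw0 : 0 ≤ cw := by rw [hcw]; exact div_nonneg (by positivity) hγ'.le
  have hcancel : ∀ k, (((L ^ k : ℕ)) : ℝ) * (cw / (((L ^ k : ℕ)) : ℝ)) = cw := fun k => mul_div_cancel₀ _ (hnk k).ne'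
  -- per-level smallness lines (as in «V-COL-TAXI-0FORM-END» file 2)
  have hsmall : ∀ k, 2 * (d : ℝ) * ((((L ^ k : ℕ)) : ℝ) * (((d - 1 : ℕ) : ℝ) * ((L ^ k - 1 : ℕ) : ℝ) * ((L : ℝ) * L * b k))) ^ 2 + 4 * γ ^ 2 ≤ 1 / 2 :=
    fun k => by
    have h1 : (((L ^ k : ℕ)) : ℝ) * (((d - 1 : ℕ) : ℝ) * ((L ^ k - 1 : ℕ) : ℝ) * ((L : ℝ) * L * b k)) ≤ ((d - 1 : ℕ) : ℝ) * c := (hcls k).1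
    have h0 : 0 ≤ (((L ^ k : ℕ)) : ℝ) * (((d - 1 : ℕ) : ℝ) * ((L ^ k - 1 : ℕ) : ℝ) * ((L : ℝ) * L * b k)) := by have := hb0 k; positivity
    have hsq := pow_le_pow_left₀ h0 h1 2
    have hd2 : (0 : ℝ) ≤ 2 * d := by positivity
    nlinarith [mul_le_mul_of_nonneg_left hsq hd2]
  have hw' : ∀ k, (4 + (((L ^ k : ℕ)) : ℝ) * (((d - 1 : ℕ) : ℝ) * ((L ^ k - 1 : ℕ) : ℝ) * ((L : ℝ) * L * b k))) / (1 - γ) - 1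
      ≤ (((L ^ k : ℕ)) : ℝ) * (cw / (((L ^ k : ℕ)) : ℝ)) := fun k => by
    rw [hcancel k, hcw]
    have h1 : (((L ^ k : ℕ)) : ℝ) * (((d - 1 : ℕ) : ℝ) * ((L ^ k - 1 : ℕ) : ℝ) * ((L : ℝ) * L * b k)) ≤ ((d - 1 : ℕ) : ℝ) * c := (hcls k).1
    have hmono : (4 + (((L ^ k : ℕ)) : ℝ) * (((d - 1 : ℕ) : ℝ) * ((L ^ k - 1 : ℕ) : ℝ) * ((L : ℝ) * L * b k))) / (1 - γ)
        ≤ (4 + ((d - 1 : ℕ) : ℝ) * c) / (1 - γ) := div_le_div_of_nonneg_right (by linarith) hγ'.le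
    linarith
  have hsmall₁ : ∀ k, 2 * (d : ℝ) * ((L : ℝ) * (((d - 1 : ℕ) : ℝ) * ((L - 1 : ℕ) : ℝ) * b k)) ^ 2 ≤ 1 / 2 := fun k => by
    have h1 : (L : ℝ) * (((d - 1 : ℕ) : ℝ) * ((L - 1 : ℕ) : ℝ) * b k) ≤ ((d - 1 : ℕ) : ℝ) * c := (hcls k).2.2.2.2.2
    have h0 : 0 ≤ (L : ℝ) * (((d - 1 : ℕ) : ℝ) * ((L - 1 : ℕ) : ℝ) * b k) := by have := hb0 k; positivity
    have hsq := pow_le_pow_left₀ h0 h1 2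
    have h4 : 0 ≤ 4 * γ ^ 2 := by positivity
    have hd2 : (0 : ℝ) ≤ 2 * d := by positivity
    nlinarith [mul_le_mul_of_nonneg_left hsq hd2]
  have habsorb : ∀ k, 64 * (d : ℝ) * ((((L ^ k : ℕ)) : ℝ) * (((d - 1 : ℕ) : ℝ) * L * ((L - 1 : ℕ) : ℝ) * b k)) ^ 2 ≤ 1 / 2 := fun k => by
    have h1 : (((L ^ k : ℕ)) : ℝ) * (((d - 1 : ℕ) : ℝ) * L * ((L - 1 : ℕ) : ℝ) * b k) ≤ ((d - 1 : ℕ) : ℝ) * c := (hcls k).2.2.2.1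
    have h0 : 0 ≤ (((L ^ k : ℕ)) : ℝ) * (((d - 1 : ℕ) : ℝ) * L * ((L - 1 : ℕ) : ℝ) * b k) := by have := hb0 k; positivity
    have hsq := pow_le_pow_left₀ h0 h1 2
    have hd2 : (0 : ℝ) ≤ 64 * d := by positivity
    nlinarith [mul_le_mul_of_nonneg_left hsq hd2]
  -- the references: the straight level-k taxi of run r's level-k bonds
  have hT₀u : ∀ r k x, taxiTv (L ^ k) M (coarseTv L (fine (L ^ k) M) (R' r k)) x ∈ unitary (E →L[ℂ] E) :=
    fun r k x => taxiTv_mem_unitary (L ^ k) M (coarseTv_mem_unitary L (fine (L ^ k) M) (hU r k)) x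
  have hw₀r : ∀ r k (x : Tor (fine (L ^ k) M)) (μ : Fin d), blockOf (L ^ k) M (x + unitVec (fine (L ^ k) M) μ) = blockOf (L ^ k) M x →
      ‖coarseTv L (fine (L ^ k) M) (R' r k) x μ * star (taxiTv (L ^ k) M (coarseTv L (fine (L ^ k) M) (R' r k)) (x + unitVec (fine (L ^ k) M) μ))
        * taxiTv (L ^ k) M (coarseTv L (fine (L ^ k) M) (R' r k)) x - 1‖ ≤ ((d - 1 : ℕ) : ℝ) * ((L ^ k - 1 : ℕ) : ℝ) * ((L : ℝ) * L * b k) :=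
    fun r k x μ hx => hw₀_taxi (L ^ k) L M (hU r k) (hb r k) hM2 x μ hx
  have hrelr : ∀ r k x, ‖nestTv L M (R' r) k x * star (taxiTv (L ^ k) M (coarseTv L (fine (L ^ k) M) (R' r k)) x) - 1‖ ≤ γ :=
    fun r k x => hrel_nestTv L M hd0 hL1r (hU r) hb0 (hb r) (hcoh r) hclass k x
  -- run k's UB⁺ ∕ P⁺ in leaf shape, from its straight level-k taxi as reference
  have hUBk : ∀ k (μ : Tor M → E), ∃ f, Qkv (L ^ k) M (nestTv L M (R' k) k) f = μ ∧
      Scv (L ^ k) M (coarseTv L (fine (L ^ k) M) (R' k k)) f ≤ 2 * d * (36 : ℝ) ^ d * ((1 + (((L ^ k : ℕ)) : ℝ) * (cw / (((L ^ k : ℕ)) : ℝ))) ^ 2 + 9) * nsqv μ :=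
    fun k => hUBc_colour_rel (L ^ k) M (hT₀u k k) (fun x μ => coarseTv_mem_unitary L (fine (L ^ k) M) (hU k k) x μ)
      (by have := hb0 k; positivity) (hw₀r k k) hγ1 (hrelr k k) (hw' k)
  have hPk : ∀ k f, qWv (L ^ k) M f ≤ 136 * (Scv (L ^ k) M (coarseTv L (fine (L ^ k) M) (R' k k)) f + nsqv (Qkv (L ^ k) M (nestTv L M (R' k) k) f)) :=
    fun k f => qWv_le_coarse_rel (L ^ k) M (hT₀u k k) (hw₀r k k) (hrelr k k) (hsmall k) f
  exact towerLimitRate_colourTwoRuns_closed_local L M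
    (Rc := fun k => coarseTv L (fine (L ^ k) M) (R' k k)) (Rb := fun k => coarseTv L (fine (L ^ k) M) (R' (k + 1) k))
    (T := fun k => nestTv L M (R' k) k) (Tb := fun k => nestTv L M (R' (k + 1)) k)
    (Tb₀ := fun k => taxiTv (L ^ k) M (coarseTv L (fine (L ^ k) M) (R' (k + 1) k)))
    (R' := fun k => R' (k + 1) k) (T' := fun k => taxiTv L (fine (L ^ k) M) (R' (k + 1) k)) hL
    (fun k x => nestTv_mem_unitary L M (hU k) k x) (fun k => cw / (((L ^ k : ℕ)) : ℝ)) (fun k => div_nonneg hcw0 (hnk k).le) hUBk hPk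
    (fun k => rfl) (fun k => hcoh (k + 1) k)
    (fun k x => nestTv_mem_unitary L M (hU (k + 1)) k x) (fun k => coarseTv_mem_unitary L (fine (L ^ k) M) (hU (k + 1) k))
    (fun k => (L : ℝ) * L * b k) (fun k => by have := hb0 k; positivity)
    (fun k x μ ν => coarseTv_plaq_le L (fine (L ^ k) M) (hR' (k + 1) k) (hb (k + 1) k) x μ ν)
    (fun k x => hT₀u (k + 1) k x)
    (fun k => ((d - 1 : ℕ) : ℝ) * ((L ^ k - 1 : ℕ) : ℝ) * ((L : ℝ) * L * b k)) (fun k => by have := hb0 k; positivity)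
    (fun k x μ hx => hw₀r (k + 1) k x μ hx)
    hγ1 (fun k x => hrelr (k + 1) k x) hsmall hw'
    (fun k x => taxiTv_mem_unitary L (fine (L ^ k) M) (hU (k + 1) k) x) (fun k => hR' (k + 1) k)
    (fun k => ((d - 1 : ℕ) : ℝ) * ((L - 1 : ℕ) : ℝ) * b k) (fun k x μ hx => hw₁_taxi (L ^ k) L M (hU (k + 1) k) (hb (k + 1) k) hM2 x μ hx) hsmall₁
    (fun k => ((d - 1 : ℕ) : ℝ) * L * ((L - 1 : ℕ) : ℝ) * b k) (fun k => by have := hb0 k; positivity)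
    (fun k y μ j => norm_misv_taxi_le L (fine (L ^ k) M) (hR' (k + 1) k) (hb (k + 1) k) y μ j) habsorb
    (fun k => ((d - 1 : ℕ) : ℝ) * ((L - 1 : ℕ) : ℝ) * ((2 * L - 1 : ℕ) : ℝ) * b k) (fun k => by have := hb0 k; positivity)
    (fun k y j μ h => hin_taxi (L ^ k) L M (hU (k + 1) k) (hb (k + 1) k) (hb0 k) y j μ h)
    (fun k y j μ h => hcross_taxiTv_le L (fine (L ^ k) M) (hU (k + 1) k) (hb (k + 1) k) y j μ h)
    (cw := cw) (cp := c) (cm := cm) (c₁ := c₁)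
    (fun k => (hcancel k).le) (fun k => (hcls k).2.1) (fun k => (hcls k).2.2.1) (fun k => (hcls k).2.2.2.2.1)
    hθ0 hθ1 (fun k => (L : ℝ) * σ k k) (fun k => ∑ j ∈ Finset.range k, (d : ℝ) * (((L - 1 : ℕ) : ℝ) * σ k j))
    (fun k => by have := hσ0 k k; positivity)
    (fun k y μ => norm_coarseTv_sub_coarseTv_le L (fine (L ^ k) M) (hR' (k + 1) k) (hR' k k) (hσ0 k k) (hσ k k) y μ) hρc
    (fun k => Finset.sum_nonneg fun j _ => by have := hσ0 k j; positivity)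
    (fun k x => norm_nestTv_sub_nestTv_le L M (h₁ := hR' (k + 1)) (h₂ := hR' k) (hσ0 k) (hσ k) k x) hτc ob ha₀

end Summit.QuantumFields.BalabanUV.T4Continuum.VariationalColourTwoRunsTaxiEnd

end
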